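import Literature.NumberTheory.QuadraticFields.ThreeTorsionMeanCubicCountProofs
import Literature.NumberTheory.CubicFields.CubicFieldCount
import HarnessLib

/-!
# BTT Thm 1.2 ⟺ the count of cubic fields of fundamental discriminant (modulo the CFT dictionary)

Topic `Literature/NumberTheory/CubicFields` × `QuadraticFields`: this file instantiates the
quadratic-side equivalence `ThreeTorsionMeanCubicCountProofs.btt_threeTorsion_sum_neg_iff_cubicCount`
(stated there for an abstract count `c : ℤ → ℕ`) with the genuine object
**`cubicFieldCountOfDisc D`** = the number of cubic fields of discriminant exactly `D`, up to
isomorphism (built like `cubicFieldCount` in `CubicFieldCount.lean`: isomorphism classes of cubic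
subfields of `ℂ`, which represent every cubic number field).

Bhargava–Taniguchi–Thorne 2023, p. 3: by class field theory (Hasse), the cubic fields `K` with
`Disc(K) = D` fundamental correspond to the index-`3` subgroups of `Cl(ℚ(√D))`, so
`#Cl₃(D) = 2 · #{K : Disc(K) = D} + 1`, and Thm 1.2 (`btt_threeTorsion_sum`) is equivalent to the
two-term asymptotic (3) for `N^±_{3,fund}(X) := Σ_{0 < ±D < X, D fund.} #{K : Disc K = D}`.
Here:

* `cubicSubfieldsOfDisc D`, `CubicFieldClassesOfDisc D`, **`cubicFieldCountOfDisc D`** — finite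
  (Hermite), representing every cubic number field of discriminant `D`
  (`exists_mem_cubicSubfieldsOfDisc_algEquiv`);
* **`btt_threeTorsion_sum_neg_iff_fundCubicFieldCount`**, **`…_pos_iff_…`** — under the
  class-field-theoretic dictionary `#Cl₃(D) = 2 · cubicFieldCountOfDisc D + 1` on fundamental `D`
  (a HYPOTHESIS here: it is the one ingredient of BTT p. 3 that neither Mathlib nor this library
  proves), each half of `btt_threeTorsion_sum` is equivalent to the printed asymptotic (3) for
  `Σ_{D ∈ negFundDiscrs X} cubicFieldCountOfDisc D` resp. `posFundDiscrs`, with main terms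
  `3/(2π²) X` resp. `1/(2π²) X`.

So `btt_threeTorsion_sum` is reduced to: (i) the CFT dictionary, (ii) the Davenport–Heilbronn /
BTT asymptotic for cubic fields of fundamental discriminant — both stated on genuine objects.

## References

* M. Bhargava, T. Taniguchi, F. Thorne, *Improved error estimates for the Davenport–Heilbronn
  theorems*, Math. Ann. 389 (2024) = arXiv:2107.12819, p. 3, Thm 1.2 and (3) [BhargavaTaniguchiThorne2023].
-/

noncomputable section

namespace Literature.NumberTheory.CubicFields

open NumberField Literature.NumberTheory.QuadraticFields

/-! ### Cubic fields of a given discriminant -/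

/-- The cubic subfields of `ℂ` of discriminant exactly `D`. [folklore] -/
def cubicSubfieldsOfDisc (D : ℤ) : Set FiniteSubfield :=
  {K | Module.finrank ℚ K = 3 ∧ discr K = D}

/-- They have bounded discriminant, hence are finitely many (Hermite). [folklore] -/
theorem cubicSubfieldsOfDisc_finite (D : ℤ) : (cubicSubfieldsOfDisc D).Finite := by
  refine (NumberField.finite_of_discr_bdd ℂ D.natAbs).subset ?_
  rintro K ⟨-, hD⟩
  change |discr K| ≤ (D.natAbs : ℤ)
  rw [hD, Int.natCast_natAbs]

/-- The cubic subfields of `ℂ` of discriminant `D` form a finite type. [folklore] -/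
instance (D : ℤ) : Finite (cubicSubfieldsOfDisc D) := (cubicSubfieldsOfDisc_finite D).to_subtype

/-- The isomorphism classes of cubic fields of discriminant `D`. [folklore] -/
def CubicFieldClassesOfDisc (D : ℤ) : Type :=
  Quotient (isoSetoid.comap (Subtype.val : cubicSubfieldsOfDisc D → FiniteSubfield))

/-- There are finitely many isomorphism classes of cubic fields of discriminant `D`. [folklore] -/
instance (D : ℤ) : Finite (CubicFieldClassesOfDisc D) := Quotient.finite _

/-- **The number of cubic fields of discriminant `D`, up to isomorphism** (for fundamental `D`:
the count in BTT p. 3, `(#Cl₃(D) − 1)/2` by class field theory). [cite: BhargavaTaniguchiThorne2023, p. 3 (cubic fields K with Disc(K) = D fundamental)] -/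
def cubicFieldCountOfDisc (D : ℤ) : ℕ :=
  Nat.card (CubicFieldClassesOfDisc D)

/-- **Every cubic number field of discriminant `D` is represented** in `cubicSubfieldsOfDisc D`
(embed it into `ℂ`). [folklore] -/
theorem exists_mem_cubicSubfieldsOfDisc_algEquiv (K : Type*) [Field K] [NumberField K]
    (h3 : Module.finrank ℚ K = 3) : ∃ F ∈ cubicSubfieldsOfDisc (discr K), Nonempty (K ≃ₐ[ℚ] F) := by
  let φ : K →ₐ[ℚ] ℂ := IsAlgClosed.lift
  let e : K ≃ₐ[ℚ] φ.fieldRange := φ.equivFieldRange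
  haveI hfd : FiniteDimensional ℚ φ.fieldRange := LinearEquiv.finiteDimensional e.toLinearEquiv
  haveI : NumberField φ.fieldRange := @NumberField.mk _ _ inferInstance hfd
  refine ⟨⟨φ.fieldRange, hfd⟩, ⟨?_, ?_⟩, ⟨e⟩⟩
  · rw [← h3]; exact (LinearEquiv.finrank_eq e.toLinearEquiv).symm
  · exact (NumberField.discr_eq_discr_of_algEquiv K e).symm

/-- Hence `cubicFieldCountOfDisc (discr K) ≥ 1` for every cubic number field `K`. [folklore] -/
theorem one_le_cubicFieldCountOfDisc (K : Type*) [Field K] [NumberField K] (h3 : Module.finrank ℚ K = 3) :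
    1 ≤ cubicFieldCountOfDisc (discr K) := by
  obtain ⟨F, hF, -⟩ := exists_mem_cubicSubfieldsOfDisc_algEquiv K h3
  rw [cubicFieldCountOfDisc, Nat.one_le_iff_ne_zero, ← Nat.pos_iff_ne_zero, Nat.card_pos_iff]
  exact ⟨⟨Quotient.mk'' ⟨F, hF⟩⟩, inferInstance⟩

/-! ### The bridge: Thm 1.2 ⟺ (3) for `N^±_{3,fund}`, modulo the CFT dictionary -/

/-- **BTT p. 3, imaginary quadratic fields, on genuine objects.** Assume the class-field-theoretic
dictionary `#Cl₃(D) = 2 · #{cubic fields of discriminant D} + 1` for negative fundamental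
discriminants `D` (Hasse / CFT; its group-theoretic half `#Cl₃ = 2 · #{index-3 subgroups} + 1` is
`ThreeTorsionProofs.quadFieldThreeTorsion_eq_two_mul_card_index_three_add_one`). Then the
imaginary half of Thm 1.2 (`btt_threeTorsion_sum`) is equivalent to the asymptotic (3):
`N⁻_{3,fund}(X) = Σ_{−X<D<0 fund.} cubicFieldCountOfDisc D = 3/(2π²) X + K X^{5/6} + O_ε(X^{2/3+ε})`. [cite: BhargavaTaniguchiThorne2023, p. 3 (Thm 1.2 ⟺ (3) via #Cl₃(D) = 2·#{K : Disc K = D} + 1)] -/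
theorem btt_threeTorsion_sum_neg_iff_fundCubicFieldCount
    (hCFT : ∀ X : ℕ, ∀ D ∈ negFundDiscrs X, quadFieldThreeTorsion D = 2 * cubicFieldCountOfDisc D + 1) :
    (∃ K : ℝ, ∀ ε : ℝ, 0 < ε → ∃ C : ℝ, ∀ X : ℕ, 1 ≤ X →
      |(∑ D ∈ negFundDiscrs X, (quadFieldThreeTorsion D : ℝ)) - 6 / Real.pi ^ 2 * X
          - K * (X : ℝ) ^ ((5 : ℝ) / 6)| ≤ C * (X : ℝ) ^ ((2 : ℝ) / 3 + ε)) ↔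
    (∃ K : ℝ, ∀ ε : ℝ, 0 < ε → ∃ C : ℝ, ∀ X : ℕ, 1 ≤ X →
      |(∑ D ∈ negFundDiscrs X, (cubicFieldCountOfDisc D : ℝ)) - 3 / (2 * Real.pi ^ 2) * X
          - K * (X : ℝ) ^ ((5 : ℝ) / 6)| ≤ C * (X : ℝ) ^ ((2 : ℝ) / 3 + ε)) :=
  btt_threeTorsion_sum_neg_iff_cubicCount hCFT

/-- **BTT p. 3, real quadratic fields, on genuine objects**: with the dictionary on positive
fundamental discriminants, the real half of Thm 1.2 is equivalent to
`N⁺_{3,fund}(X) = 1/(2π²) X + K X^{5/6} + O_ε(X^{2/3+ε})`. [cite: BhargavaTaniguchiThorne2023, p. 3 (Thm 1.2 ⟺ (3))] -/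
theorem btt_threeTorsion_sum_pos_iff_fundCubicFieldCount
    (hCFT : ∀ X : ℕ, ∀ D ∈ posFundDiscrs X, quadFieldThreeTorsion D = 2 * cubicFieldCountOfDisc D + 1) :
    (∃ K : ℝ, ∀ ε : ℝ, 0 < ε → ∃ C : ℝ, ∀ X : ℕ, 1 ≤ X →
      |(∑ D ∈ posFundDiscrs X, (quadFieldThreeTorsion D : ℝ)) - 4 / Real.pi ^ 2 * X
          - K * (X : ℝ) ^ ((5 : ℝ) / 6)| ≤ C * (X : ℝ) ^ ((2 : ℝ) / 3 + ε)) ↔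
    (∃ K : ℝ, ∀ ε : ℝ, 0 < ε → ∃ C : ℝ, ∀ X : ℕ, 1 ≤ X →
      |(∑ D ∈ posFundDiscrs X, (cubicFieldCountOfDisc D : ℝ)) - 1 / (2 * Real.pi ^ 2) * X
          - K * (X : ℝ) ^ ((5 : ℝ) / 6)| ≤ C * (X : ℝ) ^ ((2 : ℝ) / 3 + ε)) :=
  btt_threeTorsion_sum_pos_iff_cubicCount hCFT

end Literature.NumberTheory.CubicFields

end
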